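import Literature.NumberTheory.LFunctions.Zhang2022.Section14GaussSums
import Literature.NumberTheory.LFunctions.Zhang2022.Section14U004Termwise
import HarnessLib

/-!
# Zhang (2022) §14, display (14.4) — `Typed.Sec14.Eq144` DISCHARGED

Topic `Literature/NumberTheory/LFunctions/Zhang2022` (Landau–Siegel audit tree; verdict-neutral).
Y. Zhang, *Discrete mean estimates and the Landau–Siegel zero*, arXiv:2211.02515v1 (2022)
[Zhang2022LandauSiegel], §14 "Mean-value formula II", p. 77 (tex L3877–L3882) — **an unrefereed
manuscript under adjudication**; nothing here asserts or denies its Theorems 1–2, and nothing here is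
about Landau–Siegel zeros.  Theorems only (no definitions, no named facts).

The typed CLAIM node `Z22:(14.4)` (`Typed.Sec14.Eq144`, `TypedSection14.lean`: "Hence
`Σ*_{ψ (mod p)} Ĩ₂(ψ) = τ(χ)χ(p)/D Σ_d d⁻¹ Σ_k a*(dk)/k Σ_{(l,k)=1} κ*(dl)Δ(l/(Dpk))e(−lp̄/(Dk)) + O(PT^{−c})`")
is reached in print from the two preceding displays u006 ("it follows that …", tex L3866–L3871) and
u008 (`Δ = Δ₁·e`, tex L3877).  All three ingredients are tree theorems: the EDGE
`eq144_of_u008_u006b : Step14u008 → Step14u006b → Eq144` (`Section14GaussSums.lean`, termwise in the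
`l`-series, with the silent coprimality `(p, Dk) = 1` for `k ≤ 2P₄ < p`), the node
`step14u008_holds : Step14u008` (`TypedSection14.lean`) and the node
`step14u006b_holds : Step14u006b` (`Section14U004Termwise.lean`, from u006a).  This leaf records
the composite:

* `eq144_holds : Eq144` — the discharge (net debt −1), in the directory's naming convention
  (`step14uNNN_holds : Step14uNNN`).

Proposition 14.1 itself is NOT asserted here; the downstream typed deductions (`DedEq145`,
`DedProp141`) consume `Eq144` by name.

## References

* Y. Zhang, arXiv:2211.02515v1 (2022), §14 p. 77, display (14.4). [cite: Zhang2022LandauSiegel, §14 (14.4)]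
-/

noncomputable section

namespace Literature.NumberTheory.LFunctions.Zhang2022.Typed.Sec14

/-- `Z22:(14.4)` DISCHARGED. **(14.4)** (p. 77): "Hence `Σ*_{ψ (mod p)} Ĩ₂(ψ) = τ(χ)χ(p)/D Σ_d d⁻¹
Σ_k a*(dk)/k Σ_{(l,k)=1} κ*(dl)Δ(l/(Dpk))e(−lp̄/(Dk)) + O(PT^{−c})`" — the typed node `Eq144` HOLDS,
by the edge `eq144_of_u008_u006b` fed with the discharged nodes `step14u008_holds` (u008) and
`step14u006b_holds` (u006). [cite: Zhang2022LandauSiegel, §14 (14.4) p.77, tex L3877–L3882] -/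
theorem eq144_holds : Eq144 :=
  eq144_of_u008_u006b step14u008_holds step14u006b_holds

/-- `Eq144` — `_holds` alias of `eq144_holds` above under the fact's exact name (appended
2026-08-28, D-0026 bookkeeping: the proof term is the existing theorem of this file; no statement,
definition or attribute is edited; no new named fact; the ledger's debt table listed the fact
unproved). [cite: Zhang2022LandauSiegel, §14 (14.4) p.77, tex L3877–L3882] -/
theorem _root_.Literature.NumberTheory.LFunctions.Zhang2022.Typed.Sec14.Eq144_holds : Eq144 :=
  _root_.Literature.NumberTheory.LFunctions.Zhang2022.Typed.Sec14.eq144_holds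

end Literature.NumberTheory.LFunctions.Zhang2022.Typed.Sec14

end
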